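import Literature.Analysis.FluidPDE.ESSLocalHolderNoConcentration
import HarnessLib

/-!
# The far-field backward-uniqueness step on a HALF-SPACE (Escauriaza–Seregin–Šverák 2003, §3 and
# Thm. 5.1), normal form: viscosity `1`, window `]-1, 0[`

Analysis/FluidPDE proof file (theorems only: no definition, no named fact, no `sorry`).

The tree's `farField_curl_eq_zero` (`ESSLocalHolderNoConcentration.lean`) is stated on the
exterior `]-1, 0[ × {|x| > R}` of a ball and proved by REDUCTION TO HALF-SPACES: for every unit
vector `e` the time-reversed, normalised vorticity translated to `x₀ = (R+1)e` satisfies the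
hypotheses of the half-space backward uniqueness theorem in the class `C¹ ∩ {∂ₓω ∈ C¹}`
(`Carleman.backwardUniqueness_uncurried_c12`), giving `curl U = 0` on `{⟪x, e⟫ > R + 1}`. Each
direction uses the data only on the half-space `{⟪x, e⟫ > R}`. This file records the resulting
ONE-DIRECTION statement, with all hypotheses on the half-space region
`Ω_e = ]-1, 0[ × {⟪x, e⟫ > R}`:

* `farField_curl_eq_zero_halfSpace` — if `(U, π)` solves the Navier–Stokes system in `𝒟'(Ω_e)`
  with `C⁴` slices, jointly continuous `D_xⁿU` (`n ≤ 4`) and `‖D_xⁿU‖ ≤ K` (`n ≤ 3`) on `Ω_e`, and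
  `U` agrees a.e. on `Ω_e` with a field `w` whose slices tend to `0` weakly at the top time, then
  `curl U(t, ·) = 0` on `{⟪x, e⟫ > R + 1}` for every `t ∈ ]-1, 0[`. Word for word the proof of
  `farField_curl_eq_zero` for the single direction `e` (the auxiliary results
  `vorticity_c12_of_isDistributionalNSSolutionOn`, `vorticity_carleman_inequality`,
  `vorticity_pointwise_bounds`, `exists_uniform_small_near_top` are stated for an arbitrary open
  spatial set already).

Consumer: the half-space form of Lemarié-Rieusset's Thm. 15.4 (a local Leray solution whose final
value vanishes on a HALF-SPACE is trivial) and, on the finite-dissipation stratum of the crux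
`FiniteDissipationLiouville`, the angular nontriviality of the final datum.

## References

* L. Escauriaza, G. Seregin, V. Šverák, Russ. Math. Surveys 58:2 (2003) 211–250, §3
  (3.31)–(3.32), Thm. 5.1 (backward uniqueness in the half-space). [`EscauriazaSereginSverak2003`]
-/

noncomputable section

open MeasureTheory TopologicalSpace Set Function Filter Metric
open _root_.Topology
open scoped ENNReal NNReal InnerProductSpace RealInnerProductSpace Laplacian

namespace Literature.Analysis.FluidPDE

set_option maxHeartbeats 1600000 in
/-- **The far-field vorticity vanishes on a half-space** (Escauriaza–Seregin–Šverák 2003, §3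
(3.31)–(3.32) with the half-space backward uniqueness Thm. 5.1), one direction `e`, `‖e‖ = 1`:
on `Ω_e = ]-1, 0[ × {⟪x, e⟫ > R}` let `(U, π)` solve the Navier–Stokes system in the sense of
distributions with `C⁴` slices, jointly continuous spatial derivatives `D_xⁿU`, `n ≤ 4`, and
`‖D_xⁿU‖ ≤ K`, `n ≤ 3`; let `w = U` a.e. on `Ω_e` have slices tending weakly to zero at the top
time. Then `curl U(t, ·) = 0` at every point of `]-1, 0[ × {⟪x, e⟫ > R + 1}`. Proof: verbatim the
direction-`e` half of the tree's `farField_curl_eq_zero`. [cite: EscauriazaSereginSverak2003, §3 (3.31)-(3.32) and Thm. 5.1] -/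
theorem farField_curl_eq_zero_halfSpace {e : (EuclideanSpace ℝ (Fin 3))} (he : ‖e‖ = 1)
    {w U : ℝ → (EuclideanSpace ℝ (Fin 3)) → (EuclideanSpace ℝ (Fin 3))} {π : ℝ → (EuclideanSpace ℝ (Fin 3)) → ℝ} {R K : ℝ}
    (htop : ∀ φ : (EuclideanSpace ℝ (Fin 3)) → (EuclideanSpace ℝ (Fin 3)), ContDiff ℝ (⊤ : ℕ∞) φ → HasCompactSupport φ → ∀ ε : ℝ, 0 < ε →
      ∃ s₀ : ℝ, s₀ < 0 ∧ ∀ᵐ s ∂(volume.restrict (Ioo s₀ 0)), |∫ y, ⟪w s y, φ y⟫| ≤ ε)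
    (hae : uncurry U =ᵐ[volume.restrict (Ioo (-1 : ℝ) 0 ×ˢ {x : (EuclideanSpace ℝ (Fin 3)) | R < ⟪x, e⟫})] uncurry w)
    (hsol : IsDistributionalNSSolutionOn
      ⟨Ioo (-1 : ℝ) 0 ×ˢ {x : (EuclideanSpace ℝ (Fin 3)) | R < ⟪x, e⟫}, isOpen_Ioo.prod (isOpen_lt continuous_const (continuous_id.inner continuous_const))⟩
      1 0 U π)
    (hU4 : ∀ t ∈ Ioo (-1 : ℝ) 0, ContDiffOn ℝ 4 (U t) {x : (EuclideanSpace ℝ (Fin 3)) | R < ⟪x, e⟫})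
    (hΦ : ∀ n ≤ 4, ContinuousOn (fun z : ℝ × (EuclideanSpace ℝ (Fin 3)) => iteratedFDeriv ℝ n (U z.1) z.2)
      (Ioo (-1 : ℝ) 0 ×ˢ {x : (EuclideanSpace ℝ (Fin 3)) | R < ⟪x, e⟫}))
    (hK : ∀ n ≤ 3, ∀ z ∈ Ioo (-1 : ℝ) 0 ×ˢ {x : (EuclideanSpace ℝ (Fin 3)) | R < ⟪x, e⟫},
      ‖iteratedFDeriv ℝ n (U z.1) z.2‖ ≤ K) :
    ∀ z ∈ Ioo (-1 : ℝ) 0 ×ˢ {x : (EuclideanSpace ℝ (Fin 3)) | R + 1 < ⟪x, e⟫}, curl (U z.1) z.2 = 0 := by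
  -- ### notation and basic facts
  set I : Set ℝ := Ioo (-1 : ℝ) 0 with hI
  set S : Set (EuclideanSpace ℝ (Fin 3)) := {x : (EuclideanSpace ℝ (Fin 3)) | R < ⟪x, e⟫} with hSdef
  have hIo : IsOpen I := isOpen_Ioo
  have hSo : IsOpen S := isOpen_lt continuous_const (continuous_id.inner continuous_const)
  set O : Set (ℝ × (EuclideanSpace ℝ (Fin 3))) := I ×ˢ S with hOdef
  have hOo : IsOpen O := hIo.prod hSo
  have hK0 : 0 ≤ K := by
    have hz : ((-(1 : ℝ) / 2, (R + 1) • e) : ℝ × (EuclideanSpace ℝ (Fin 3))) ∈ O := by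
      refine ⟨⟨by norm_num, by norm_num⟩, ?_⟩
      show R < ⟪(R + 1) • e, e⟫
      rw [real_inner_smul_left, real_inner_self_eq_norm_sq, he]
      linarith
    exact (norm_nonneg _).trans (hK 0 (by norm_num) _ hz)
  -- bounds on `U` and `D U` in the usual form
  have hK₀ : ∀ z ∈ O, ‖U z.1 z.2‖ ≤ K := fun z hz => by
    have h := hK 0 (by norm_num) z hz
    rwa [norm_iteratedFDeriv_zero] at h
  have hK₁ : ∀ z ∈ O, ‖fderiv ℝ (U z.1) z.2‖ ≤ K := fun z hz => by
    have h := hK 1 (by norm_num) z hz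
    rwa [norm_iteratedFDeriv_one] at h
  -- ### the vorticity: class, equation, bounds
  obtain ⟨-, hU0, hderiv, hω1, hωx⟩ :=
    vorticity_c12_of_isDistributionalNSSolutionOn hIo hSo hsol hU4 hΦ
  obtain ⟨hdt, -, hineq⟩ := vorticity_carleman_inequality hIo hSo hsol hU4 hΦ hK₀ hK₁
  have hκ0 : 0 ≤ ‖curlCLM‖ := ContinuousLinearMap.opNorm_nonneg _
  -- pointwise bounds: `|ω| ≤ ‖curlCLM‖K`, `|∂ₜω| ≤ (3 * 1 * ‖curlCLM‖ * K + 2 * ‖curlCLM‖ * K ^ 2)`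
  have hbounds : ∀ z ∈ O, ‖(uncurry (vorticity U)) z‖ ≤ ‖curlCLM‖ * K ∧ ‖Carleman.dt (uncurry (vorticity U)) z‖ ≤ (3 * 1 * ‖curlCLM‖ * K + 2 * ‖curlCLM‖ * K ^ 2) := by
    intro z hz
    have hU3 : ContDiffOn ℝ 3 (U z.1) S := (hU4 z.1 hz.1).of_le (by norm_cast)
    obtain ⟨b0, -, -, b3⟩ := vorticity_pointwise_bounds hSo hU3 hz.2 hK0 zero_le_one
      (hK₀ z hz) (hK₁ z hz) (hK 2 (by norm_num) z hz) (hK 3 le_rfl z hz)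
    refine ⟨?_, ?_⟩
    · show ‖vorticity U z.1 z.2‖ ≤ _
      simpa [vorticity_apply] using b0
    · rw [hdt z hz]
      simpa [vorticity_apply] using b3
  -- ### uniform smallness at the top
  have hU2 : ∀ z ∈ O, ContDiffAt ℝ 2 (U z.1) z.2 := fun z hz =>
    ((hU4 z.1 hz.1).of_le (by norm_cast)).contDiffAt (hSo.mem_nhds hz.2)
  have hK₂ : ∀ z ∈ O, ‖iteratedFDeriv ℝ 2 (U z.1) z.2‖ ≤ K := fun z hz => hK 2 (by norm_num) z hz
  have hsmall := fun (x₀ : (EuclideanSpace ℝ (Fin 3))) (hx₀ : x₀ ∈ S) (θ : ℝ) (hθ : 0 < θ) =>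
    exists_uniform_small_near_top (w := w) (U := U) (a := -1) (by norm_num) hSo htop hae hU0 hU2
      hK₁ hK₂ hx₀ hθ
  -- ### reduction to half-spaces through `x₀ = (R + 1) e`
  suffices hhalf : ∀ t ∈ I, ∀ x : (EuclideanSpace ℝ (Fin 3)), R + 1 < ⟪x, e⟫ → curl (U t) x = 0 by
    rintro ⟨t, x⟩ ⟨ht, hx⟩
    exact hhalf t ht x hx
  set x₀ : (EuclideanSpace ℝ (Fin 3)) := (R + 1) • e with hx₀def
  set H : Set (EuclideanSpace ℝ (Fin 3)) := {y : (EuclideanSpace ℝ (Fin 3)) | 0 < ⟪y, e⟫} with hHdef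
  have hHo : IsOpen H := isOpen_lt continuous_const (continuous_id.inner continuous_const)
  set Q : Set (ℝ × (EuclideanSpace ℝ (Fin 3))) := Ioo (0 : ℝ) 1 ×ˢ H with hQdef
  have hQo : IsOpen Q := isOpen_Ioo.prod hHo
  -- the affine change of variables `A(s, y) = (-s, x₀ + y)`
  set A : ℝ × (EuclideanSpace ℝ (Fin 3)) → ℝ × (EuclideanSpace ℝ (Fin 3)) := stAffine (-1) 1 0 x₀ with hAdef
  have hA : ∀ z : ℝ × (EuclideanSpace ℝ (Fin 3)), A z = (-z.1, x₀ + z.2) := fun z => by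
    simp [hAdef, stAffine]
  have hx₀S : ∀ y ∈ H, x₀ + y ∈ S := by
    intro y hy
    have hy' : 0 < ⟪y, e⟫ := hy
    show R < ⟪x₀ + y, e⟫
    rw [inner_add_left, hx₀def, real_inner_smul_left, real_inner_self_eq_norm_sq, he]
    linarith
  have hAO : ∀ z ∈ Q, A z ∈ O := by
    rintro ⟨s', y⟩ ⟨hs', hy⟩
    rw [hA]
    exact ⟨⟨by linarith [hs'.2], by linarith [hs'.1]⟩, hx₀S y hy⟩
  have hpre : Q ⊆ A ⁻¹' O := fun z hz => hAO z hz
  -- the normalised, time-reversed vorticity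
  set c₀ : ℝ := (‖curlCLM‖ * K + 1)⁻¹ with hc₀def
  have hc₀ : 0 < c₀ := by positivity
  have hc₀1 : c₀ * (‖curlCLM‖ * K) ≤ 1 := by
    rw [hc₀def, inv_mul_le_iff₀ (by positivity)]
    linarith
  set ut : ℝ × (EuclideanSpace ℝ (Fin 3)) → (EuclideanSpace ℝ (Fin 3)) := fun z => c₀ • (uncurry (vorticity U)) (A z) with hutdef
  set u : ℝ × (EuclideanSpace ℝ (Fin 3)) → (EuclideanSpace ℝ (Fin 3)) := fun z => if 0 < z.1 then ut z else 0 with hudef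
  have huQ : ∀ z ∈ Q, u z = ut z := fun z hz => if_pos hz.1.1
  -- ### regularity of `ut` and `u` on `Q`
  have hut1 : ContDiffOn ℝ 1 ut Q :=
    ((Carleman.contDiffOn_comp_stAffine hω1 (-1) 1 0 x₀).const_smul c₀).mono hpre
  have hdxut : ∀ e' : (EuclideanSpace ℝ (Fin 3)), Carleman.dx e' ut = fun z => c₀ • Carleman.dx e' (uncurry (vorticity U)) (A z) := by
    intro e'
    rw [hutdef, Carleman.dx_const_smul_eq]
    funext z
    rw [Carleman.dx_comp_stAffine (by norm_num) one_ne_zero (uncurry (vorticity U)) e' z, one_smul]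
  have hutx : ∀ e' : (EuclideanSpace ℝ (Fin 3)), ContDiffOn ℝ 1 (Carleman.dx e' ut) Q := by
    intro e'
    rw [hdxut e']
    exact ((Carleman.contDiffOn_comp_stAffine (hωx e') (-1) 1 0 x₀).const_smul c₀).mono hpre
  have hframe : ∀ z ∈ Q, Carleman.dt u z = Carleman.dt ut z ∧
      (∀ e', Carleman.dx e' u z = Carleman.dx e' ut z) ∧
      (∀ e', Carleman.dx e' (Carleman.dx e' u) z = Carleman.dx e' (Carleman.dx e' ut) z) ∧
      Carleman.lap u z = Carleman.lap ut z ∧ Carleman.gradSq u z = Carleman.gradSq ut z :=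
    fun z hz => Carleman.frame_eq_of_eventuallyEq hQo hz huQ
  have hu1 : ContDiffOn ℝ 1 u Q := hut1.congr huQ
  have hux : ∀ e' : (EuclideanSpace ℝ (Fin 3)), ContDiffOn ℝ 1 (Carleman.dx e' u) Q := fun e' =>
    (hutx e').congr fun z hz => (hframe z hz).2.1 e'
  -- frame operators of `ut` in terms of those of `(uncurry (vorticity U))`
  have hdtut : ∀ z, Carleman.dt ut z = c₀ • ((-1 : ℝ) • Carleman.dt (uncurry (vorticity U)) (A z)) := fun z => by
    rw [hutdef, Carleman.dt_const_smul_apply, Carleman.dt_comp_stAffine (by norm_num) one_ne_zero]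
  have hlaput : ∀ z, Carleman.lap ut z = c₀ • Carleman.lap (uncurry (vorticity U)) (A z) := fun z => by
    rw [hutdef, Carleman.lap_const_smul_apply, Carleman.lap_comp_stAffine (by norm_num) one_ne_zero,
      one_pow, one_smul]
  have hgradut : ∀ z, Carleman.gradSq ut z = c₀ ^ 2 * Carleman.gradSq (uncurry (vorticity U)) (A z) := fun z => by
    rw [hutdef, Carleman.gradSq_const_smul_apply, Carleman.gradSq_comp_stAffine (by norm_num) one_ne_zero,
      one_pow, one_mul]
  have hnormut : ∀ z, ‖ut z‖ = c₀ * ‖(uncurry (vorticity U)) (A z)‖ := fun z => by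
    rw [hutdef, norm_smul, Real.norm_eq_abs, abs_of_pos hc₀]
  have hsqrtut : ∀ z, Real.sqrt (Carleman.gradSq ut z) = c₀ * Real.sqrt (Carleman.gradSq (uncurry (vorticity U)) (A z)) :=
    fun z => by rw [hgradut, Real.sqrt_mul (sq_nonneg _), Real.sqrt_sq hc₀.le]
  -- ### (hBH) the differential inequality
  have hBH : ∀ z ∈ Q, ‖Carleman.dt u z + Carleman.lap u z‖ ≤
      (2 * K) * (‖u z‖ + Real.sqrt (Carleman.gradSq u z)) := by
    intro z hz
    obtain ⟨h1, -, -, h4, h5⟩ := hframe z hz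
    rw [h1, h4, h5, huQ z hz, hdtut, hlaput, hnormut, hsqrtut]
    have e1 : c₀ • ((-1 : ℝ) • Carleman.dt (uncurry (vorticity U)) (A z)) + c₀ • Carleman.lap (uncurry (vorticity U)) (A z) =
        -(c₀ • (Carleman.dt (uncurry (vorticity U)) (A z) - Carleman.lap (uncurry (vorticity U)) (A z))) := by
      simp only [smul_sub, neg_one_smul, smul_neg]
      abel
    rw [e1, norm_neg, norm_smul, Real.norm_eq_abs, abs_of_pos hc₀]
    have h := hineq (A z) (hAO z hz)
    calc c₀ * ‖Carleman.dt (uncurry (vorticity U)) (A z) - Carleman.lap (uncurry (vorticity U)) (A z)‖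
        ≤ c₀ * ((K + K) * (‖(uncurry (vorticity U)) (A z)‖ + Real.sqrt (Carleman.gradSq (uncurry (vorticity U)) (A z)))) :=
          mul_le_mul_of_nonneg_left h hc₀.le
      _ = (2 * K) * (c₀ * ‖(uncurry (vorticity U)) (A z)‖ + c₀ * Real.sqrt (Carleman.gradSq (uncurry (vorticity U)) (A z))) := by ring
  -- ### (hgrowth), (h0)
  have hgrowth : ∀ z ∈ Q, ‖u z‖ ≤ Real.exp (0 * ‖z.2‖ ^ 2) := by
    intro z hz
    rw [zero_mul, Real.exp_zero, huQ z hz, hnormut]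
    calc c₀ * ‖(uncurry (vorticity U)) (A z)‖ ≤ c₀ * (‖curlCLM‖ * K) := mul_le_mul_of_nonneg_left (hbounds _ (hAO z hz)).1 hc₀.le
      _ ≤ 1 := hc₀1
  have h0 : ∀ y : (EuclideanSpace ℝ (Fin 3)), 0 < ⟪y, e⟫ → u (0, y) = 0 := fun y _ => if_neg (lt_irrefl 0)
  -- ### (hH3) square integrability of `∂ₜu` on bounded sets
  have hH3 : ∀ K' ⊆ Q, Bornology.IsBounded K' → MeasurableSet K' →
      ∫⁻ z in K', ‖Carleman.dt u z‖ₑ ^ 2 < ∞ := by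
    intro K' hK' hK'b hK'm
    have hbd : ∀ z ∈ K', ‖Carleman.dt u z‖ₑ ^ 2 ≤ ENNReal.ofReal ((c₀ * (3 * 1 * ‖curlCLM‖ * K + 2 * ‖curlCLM‖ * K ^ 2)) ^ 2) := by
      intro z hz
      have hzQ := hK' hz
      rw [(hframe z hzQ).1, hdtut]
      have hn : ‖c₀ • ((-1 : ℝ) • Carleman.dt (uncurry (vorticity U)) (A z))‖ ≤ c₀ * (3 * 1 * ‖curlCLM‖ * K + 2 * ‖curlCLM‖ * K ^ 2) := by
        rw [norm_smul, norm_smul, Real.norm_eq_abs, abs_of_pos hc₀, Real.norm_eq_abs, abs_neg,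
          abs_one, one_mul]
        exact mul_le_mul_of_nonneg_left (hbounds _ (hAO z hzQ)).2 hc₀.le
      have h0n : 0 ≤ c₀ * (3 * 1 * ‖curlCLM‖ * K + 2 * ‖curlCLM‖ * K ^ 2) := (norm_nonneg _).trans hn
      calc ‖c₀ • ((-1 : ℝ) • Carleman.dt (uncurry (vorticity U)) (A z))‖ₑ ^ 2
          = ENNReal.ofReal (‖c₀ • ((-1 : ℝ) • Carleman.dt (uncurry (vorticity U)) (A z))‖ ^ 2) := by
            rw [← ofReal_norm, ENNReal.ofReal_pow (norm_nonneg _)]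
        _ ≤ ENNReal.ofReal ((c₀ * (3 * 1 * ‖curlCLM‖ * K + 2 * ‖curlCLM‖ * K ^ 2)) ^ 2) :=
            ENNReal.ofReal_le_ofReal (pow_le_pow_left₀ (norm_nonneg _) hn 2)
    calc ∫⁻ z in K', ‖Carleman.dt u z‖ₑ ^ 2
        ≤ ∫⁻ _ in K', ENNReal.ofReal ((c₀ * (3 * 1 * ‖curlCLM‖ * K + 2 * ‖curlCLM‖ * K ^ 2)) ^ 2) := setLIntegral_mono' hK'm hbd
      _ = ENNReal.ofReal ((c₀ * (3 * 1 * ‖curlCLM‖ * K + 2 * ‖curlCLM‖ * K ^ 2)) ^ 2) * volume K' := setLIntegral_const _ _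
      _ < ∞ := ENNReal.mul_lt_top ENNReal.ofReal_lt_top hK'b.measure_lt_top
  -- ### (hcont) continuity up to the initial plane
  have hutcQ : ∀ z ∈ Q, ContinuousAt ut z := by
    intro z hz
    have h1 : ContinuousAt (uncurry (vorticity U)) (A z) := hω1.continuousOn.continuousAt (hOo.mem_nhds (hAO z hz))
    have h2 : ContinuousAt A z := (continuous_stAffine (-1 : ℝ) 1 0 x₀).continuousAt
    exact (h1.comp_of_eq h2 rfl).const_smul c₀
  have hcont : ContinuousOn u (Ico (0 : ℝ) 1 ×ˢ H) := by
    rintro ⟨s', y⟩ ⟨hs', hy⟩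
    rcases (hs'.1).eq_or_lt with h0s | hspos
    · -- the bottom `s' = 0`
      subst h0s
      rw [Metric.continuousWithinAt_iff]
      intro ε hε
      set θ : ℝ := ε / (2 * (c₀ * ‖curlCLM‖ + 1)) with hθdef
      have hθ : 0 < θ := by positivity
      have hθε : c₀ * ‖curlCLM‖ * θ < ε := by
        have h1 : c₀ * ‖curlCLM‖ * θ ≤ (c₀ * ‖curlCLM‖ + 1) * θ := by nlinarith
        have h2 : (c₀ * ‖curlCLM‖ + 1) * θ = ε / 2 := by rw [hθdef]; field_simp
        linarith
      obtain ⟨s₀, δ₁, hs₀, -, hδ₁, hsm⟩ := hsmall (x₀ + y) (hx₀S y hy) θ hθ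
      refine ⟨min (-s₀) δ₁, lt_min (by linarith) hδ₁, ?_⟩
      rintro ⟨s'', y'⟩ ⟨hs'', hy'⟩ hdist
      rw [Prod.dist_eq, max_lt_iff] at hdist
      obtain ⟨hd1, hd2⟩ := hdist
      rw [Real.dist_eq, sub_zero] at hd1
      have hu0 : u (0, y) = 0 := if_neg (lt_irrefl 0)
      rw [hu0, dist_zero_right]
      rcases (hs''.1).eq_or_lt with h0 | hpos
      · have hs0 : s'' = 0 := by simpa using h0.symm
        have : u (s'', y') = 0 := by
          show (if (0 : ℝ) < s'' then ut (s'', y') else 0) = 0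
          rw [hs0, if_neg (lt_irrefl 0)]
        rw [this, norm_zero]; exact hε
      · have hzQ : ((s'', y') : ℝ × (EuclideanSpace ℝ (Fin 3))) ∈ Q := ⟨⟨hpos, hs''.2⟩, hy'⟩
        rw [huQ _ hzQ, hnormut, hA]
        have hs''abs : |s''| = s'' := abs_of_pos hpos
        have hneg : -s'' ∈ Ioo s₀ 0 := ⟨by
            have : s'' < -s₀ := by rw [← hs''abs]; exact hd1.trans_le (min_le_left _ _)
            linarith, by linarith⟩
        have hball : x₀ + y' ∈ ball (x₀ + y) δ₁ := by
          rw [mem_ball, dist_eq_norm, add_sub_add_left_eq_sub, ← dist_eq_norm]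
          exact hd2.trans_le (min_le_right _ _)
        obtain ⟨-, hD⟩ := hsm (-s'') hneg (x₀ + y') hball
        have hω : ‖(uncurry (vorticity U)) (-s'', x₀ + y')‖ ≤ ‖curlCLM‖ * θ := by
          show ‖vorticity U (-s'') (x₀ + y')‖ ≤ ‖curlCLM‖ * θ
          rw [vorticity_apply]
          exact (norm_curl_le _ _).trans (mul_le_mul_of_nonneg_left hD hκ0)
        calc c₀ * ‖(uncurry (vorticity U)) (-s'', x₀ + y')‖ ≤ c₀ * (‖curlCLM‖ * θ) := mul_le_mul_of_nonneg_left hω hc₀.le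
          _ = c₀ * ‖curlCLM‖ * θ := by ring
          _ < ε := hθε
    · -- interior points `s' > 0`
      have hzQ : ((s', y) : ℝ × (EuclideanSpace ℝ (Fin 3))) ∈ Q := ⟨⟨hspos, hs'.2⟩, hy⟩
      have hev : u =ᶠ[𝓝 ((s', y) : ℝ × (EuclideanSpace ℝ (Fin 3)))] ut := by
        filter_upwards [(isOpen_lt continuous_const continuous_fst).mem_nhds
          (show (0 : ℝ) < ((s', y) : ℝ × (EuclideanSpace ℝ (Fin 3))).1 from hspos)] with z hz
        exact if_pos hz
      exact ((hutcQ _ hzQ).congr_of_eventuallyEq hev).continuousWithinAt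
  -- ### backward uniqueness
  have hzero := Carleman.backwardUniqueness_uncurried_c12 (E := (EuclideanSpace ℝ (Fin 3))) (F := (EuclideanSpace ℝ (Fin 3)))
    uniqueContinuation_input_c12 he (c₁ := 2 * K) (M := 0) (by positivity) le_rfl hu1 hux hcont h0
    hBH hgrowth hH3
  -- ### conclusion
  intro t ht x hx
  set z : ℝ × (EuclideanSpace ℝ (Fin 3)) := (-t, x - x₀) with hzdef
  have hxH : x - x₀ ∈ H := by
    show 0 < ⟪x - x₀, e⟫
    rw [inner_sub_left, hx₀def, real_inner_smul_left, real_inner_self_eq_norm_sq, he]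
    nlinarith
  have hzQ : z ∈ Q := ⟨⟨by linarith [ht.2], by linarith [ht.1]⟩, hxH⟩
  have h := hzero z hzQ
  rw [huQ z hzQ, hutdef] at h
  have h' : (uncurry (vorticity U)) (A z) = 0 := by
    rcases smul_eq_zero.1 h with h1 | h1
    · exact absurd h1 hc₀.ne'
    · exact h1
  have hAz : A z = (t, x) := by
    rw [hA]; simp [hzdef]
  rw [hAz] at h'
  simpa [vorticity_apply] using h'

end Literature.Analysis.FluidPDE

end
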